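import Summits.QuantumFields.YangMills.Theorems.FluctuationComparisonRegPrIntLS2BetaOneLevelStepLetters
import Summits.QuantumFields.YangMills.Theorems.FluctuationComparisonRegPrIntLS2BetaNeighbourhoodKernelTorus
import Summits.QuantumFields.YangMills.Theorems.FluctuationComparisonRegPrIntLS2BetaHybridFourSlot
import Summits.QuantumFields.YangMills.Theorems.FluctuationComparisonRegPrIntLS2BetaChainCouplingCost
import HarnessLib

/-!
# S2β · `hFlat` road, UV3-NODE §57.8 (C) ∕ §64.2 — THE (C)-STEP: THE `hstep` ∕ `hj` DISCHARGERS OF ✓`…KeyLemmaSkeleton.keyLemma_tower` FOR ONE (0.4) AVERAGING WITH THE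
# PRINTED `exp[mean log]` ON `SU(N)`: `dist1 Ū(∂Q) ≤ (1 + C₁θ)·Σ_p K Q p·dist1 U(∂p) + C₂·θ·(local plaquette size)`

Cell `ym3-torus` (rung R3 = continuum `SU(2)` Yang–Mills on the three-torus — NOT d = 4, NOT infinite volume, NOT a mass gap, NOT Clay).
Width seat «width 10» `ym3-torus-px10` (gen 22), FREE px helper on crux `stmt-QuantumFields-20520`, count-neutral, DEFINITION-FREE; pen «(C)-STEP» named by px8 g21 (08:11:35Z).

THE STEP (one level `j → j+1`, standing range, `Ū = avgFun ℰ U`, `ℰ = expMeanLogSU` the printed `exp[|I|⁻¹Σ log]` of [Balaban1987RG1] (0.4) with its guard;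
`τ := ((d+2)L)²∕4·θ` the member size of lit ✓`dist1_loopHol_le`; GLOBAL hypothesis `PlaqSmall θ U` with `((d+2)L)²·θ ≤ 1∕50`, `τ < δ_N`; LOCAL datum `a ≥ 0` bounding the
fine plaquettes based in the blocks near `Q₋`):
 (F) `dist1 Ū(∂Q) ≤ (1 + 50τ)·‖log Ū(∂Q)‖` (lit (27) `‖X − 1‖ ≤ e^{‖log X‖} − 1`, Mathlib `|eˣ − 1 − x| ≤ x²`);
 (A) `Ū(∂Q) = E₁E₂E₃E₄·H₀` (✓G9 `plaqWord_avgFun_eq_loopForm`), `E_m = exp ā_m` (`coe_avg_eq_exp_mean`: the guard holds, `ESU = eml = exp[mean mlog]`);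
 (C) ✓G10 `norm_mlog_word4_sub_mean4_le`: `‖log(E₁E₂E₃E₄H₀) − mean⁴ Ψ‖ ≤ 128(e^{8τ} − 1)·Σ_m fl_m`, `Ψ i j k l = log(W₁ᵢW₂ⱼW₃ₖW₄ₗH₀)`, `fl_m ≤ 4τ_loc`;
 (D) ✓G5 §3 `norm_mean_chain4_sub_mean_indep_le` with the chain `τ, 1, τ` (`τ (r,σ,σ′) = (r,σ′,σ)`) + ✓G6 `norm_coupled_sub_indep_wordMean_le` ×3 (centre `c := 1`,
     `s := 4τ` GLOBAL, `mean‖P_i − 1‖ ≤ 3τ_loc` LOCAL): `‖mean⁴ Ψ − mean_i Ψ i (τi) (τi) i‖ ≤ 12288·τ·τ_loc`;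
 (E) `‖Ψ i (τi) (τi) i‖ = ‖log U(∂□_L(x_{r(i)}))‖ ≤ (1 + 2τ)·dist1 U(∂□_L(x_r))` (✓FILE 1 `chainWord_eq_conj_rect` + ✓G9 `word_conj_rewrite`, `log` of a unitary conjugate, lit (26)),
     and `mean_i dist1 U(∂□_L(x_r)) ≤ Σ_p K Q p·dist1 U(∂p)` (✓FILE 1 `mean_dist1_rect_le_tentKernel`, constant ONE).
 Collecting: ★★★ `oneLevelStep`: `dist1 Ū(∂Q) ≤ (1 + 14·((d+2)L)²·θ)·Σ_p K Q p·dist1 U(∂p) + 8192·((d+2)L)⁴·θ·a`; ★★★ `oneLevelStep_nbhd` (`a :=` the neighbourhood SUM);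
 ★★★ `hstep_hj` — the pair (`hstep`, `hj`) of ✓`keyLemma_level` VERBATIM: `θ_t := 14((d+2)L)²θ`, `ε_t := 8192((d+2)L)⁴θ·√((3^dL^dd²)(3^dd²))` (✓FILE 2 `sqrt_sum_sq_le_of_le_nbhd_sum`).

HONEST SCOPE.  A composition of landed bookkeeping letters with explicit admissible (not optimal) constants; the analytic inputs are the Banach-algebra estimates of
✓G4∕✓G6∕✓G10∕lit (26)–(27); nothing of Bałaban's renormalisation analysis ([Balaban1985RegularSpaces] Lemma 1 ∕ Thm 2) is asserted as proved; the KEY LEMMA's tower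
(✓G11 is the skeleton; the T³ threshold schedule `Σθ_t < ∞` and the assembly are the (C)-assembler's), `hFlat`, TUBE-REG∘, GAP♯∘, S2β, crux 20520 and `YM3TorusSU2` are NOT
proved; no registered stub is closed; the Yang–Mills mass gap is NOT proved.
References: T. Bałaban, CMP **109** (1987) 249–301 [Balaban1987RG1] ((0.4)–(0.8) p.253); CMP **98** (1985) 17–51 [Balaban1985Averaging] ((19) p.21, (26)–(27) p.22);
CMP **99** (1985) 75–102 [Balaban1985RegularSpaces] (Lemma 1 p.79 — the printed one-step locus this kinematic∕analytic split serves).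
-/

set_option autoImplicit false

noncomputable section

namespace Summit.QuantumFields.YangMills.Theorems.FluctuationComparisonRegPrIntLS2BetaOneLevelStep

open NormedSpace Finset
open scoped BigOperators Matrix.Norms.L2Operator
open Literature.MathematicalPhysics.QuantumFieldTheory.Balaban1983to89
open Literature.MathematicalPhysics.QuantumFieldTheory.Balaban1983to89.T4Continuum
open Literature.MathematicalPhysics.QuantumFieldTheory.Balaban1983to89.AveragingRT
open Literature.MathematicalPhysics.QuantumFieldTheory.Balaban1983to89.BlockAveraging
open Literature.MathematicalPhysics.QuantumFieldTheory.Balaban1983to89.MatrixLog (mlog exp_mlog norm_mlog_le_div norm_mlog_le_two_mul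
  norm_sub_one_le_exp_norm_mlog_sub_one)
open Literature.MathematicalPhysics.QuantumFieldTheory.Balaban1983to89.ExpMeanLog (eml eml_eq_exp ESU coe_ESU_of_small expMeanLogSU deltaSU mlog_conj)
open Literature.MathematicalPhysics.QuantumFieldTheory.Balaban1983to89.LatticeWordStokes (dist1_loopHol_le small_of_plaqSmall)
open B10Eq47AxialChi (shiftN rect plaqSmall_axialAvg)

variable {n : Type*} [Fintype n] [DecidableEq n] [Nonempty n]
variable {P : Params} {j : ℕ}

open Summit.QuantumFields.YangMills.Theorems.FluctuationComparisonRegPrIntLS2BetaOneLevelStepLetters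

/-! ## §3 The (C)-STEP -/

section Step

set_option maxHeartbeats 400000 in
/-- ★★★ **THE (C)-STEP** (UV3-NODE §64.2 (1)–(3) as one inequality, `SU(N)`, `ℰ = expMeanLogSU`, standing range `j + 1 ≤ m + K`): under the GLOBAL small-field hypothesis
`PlaqSmall θ U` with `((d+2)L)²·θ ≤ 1∕50` and `((d+2)L)²∕4·θ < δ_N`, for every coarse plaquette `Q` and every LOCAL bound `a ≥ 0` on the fine plaquettes based in the blocks
near `Q₋` (`∀ κ, (blockOf q₋)_κ ∈ {y_κ, y_κ ± 1}`):
`dist1 Ū(∂Q) ≤ (1 + 14·((d+2)L)²·θ) · Σ_p K Q p · dist1 U(∂p) + 4096·((d+2)L)⁴·θ·a`, with `K` px12 g23's one-level tent kernel VERBATIM (row sums `L²`, column sums `L^{2−d}`) — the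
MAIN TERM has constant `1 + O(θ)` (hairpin collapse + Stokes in squares, constant one), the JUNK is (global threshold) × (local size). [cite: Balaban1987RG1, (0.4)-(0.8) p.253] -/
theorem oneLevelStep (hj : j + 1 ≤ P.m + P.K) (U : GaugeField P j (Matrix.specialUnitaryGroup n ℂ)) {θ : ℝ} (hθ0 : 0 ≤ θ)
    (hθ : (((P.d + 2) * P.L : ℕ) : ℝ) ^ 2 * θ ≤ 1 / 50) (hδ : (((P.d + 2) * P.L : ℕ) : ℝ) ^ 2 / 4 * θ < deltaSU n)
    (hU : PlaqSmall θ U) (Q : Plaq P (j + 1)) {a : ℝ} (ha : 0 ≤ a)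
    (hloc : ∀ q : Plaq P j, (∀ κ, blockOf q.src κ = Q.src κ ∨ blockOf q.src κ = Q.src κ + 1 ∨ blockOf q.src κ = Q.src κ - 1) →
      dist1 (GaugeField.plaqHol U q) < a) :
    dist1 (GaugeField.plaqHol (avgFun (expMeanLogSU (n := n)) U) Q) ≤
      (1 + 14 * (((P.d + 2) * P.L : ℕ) : ℝ) ^ 2 * θ) *
          ∑ p : Plaq P j, ((P.L : ℝ) ^ P.d)⁻¹ * (((block Q.src).filter (fun x : Site P j => p.μ = Q.μ ∧ p.ν = Q.ν ∧
            ∃ a ∈ range P.L, ∃ b ∈ range P.L, p.src = shiftN (shiftN x Q.μ a) Q.ν b)).card : ℝ) * dist1 (GaugeField.plaqHol U p) +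
        4096 * (((P.d + 2) * P.L : ℕ) : ℝ) ^ 4 * θ * a := by
  -- ### thresholds
  set cc : ℝ := (((P.d + 2) * P.L : ℕ) : ℝ) ^ 2 / 4 with hcc
  set τ : ℝ := cc * θ with hτdef
  set τa : ℝ := cc * a with hτadef
  have hcc0 : 0 ≤ cc := by positivity
  have hτ0 : 0 ≤ τ := mul_nonneg hcc0 hθ0
  have hτa0 : 0 ≤ τa := mul_nonneg hcc0 ha
  have hτs : τ ≤ 1 / 200 := by rw [hτdef, hcc]; linarith
  have hL2 : (P.L : ℝ) ^ 2 * θ ≤ τ := by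
    rw [hτdef]; exact mul_le_mul_of_nonneg_right (sq_L_le_quarter P) hθ0
  -- ### the four bonds, transporters, member families
  set ℰ : LoopAverage (Matrix.specialUnitaryGroup n ℂ) := expMeanLogSU (n := n) with hℰ
  set c₁ : PBond P (j + 1) := ⟨Q.src, Q.μ⟩ with hc₁
  set c₂ : PBond P (j + 1) := ⟨Q.src.shift Q.μ, Q.ν⟩ with hc₂
  set c₃ : PBond P (j + 1) := ⟨Q.src.shift Q.ν, Q.μ⟩ with hc₃
  set c₄ : PBond P (j + 1) := ⟨Q.src, Q.ν⟩ with hc₄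
  set A₁ := axialAvg U c₁ with hA₁
  set A₂ := axialAvg U c₂ with hA₂
  set A₃ := axialAvg U c₃ with hA₃
  set A₄ := axialAvg U c₄ with hA₄
  set P₃ := A₁ * A₂ * A₃⁻¹ with hP₃
  set H₀ := A₁ * A₂ * A₃⁻¹ * A₄⁻¹ with hH₀
  set W₁ : Idx P → Matrix.specialUnitaryGroup n ℂ := fun i => loopHol U c₁ i with hW₁
  set W₂ : Idx P → Matrix.specialUnitaryGroup n ℂ := fun i => A₁ * loopHol U c₂ i * A₁⁻¹ with hW₂
  set W₃ : Idx P → Matrix.specialUnitaryGroup n ℂ := fun i => P₃ * (loopHol U c₃ i)⁻¹ * P₃⁻¹ with hW₃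
  set W₄ : Idx P → Matrix.specialUnitaryGroup n ℂ := fun i => H₀ * (loopHol U c₄ i)⁻¹ * H₀⁻¹ with hW₄
  -- ### global sizes (lit `dist1_loopHol_le`) and local sizes (✓FILE 2)
  have hg : ∀ c i, dist1 (loopHol U c i) ≤ τ := fun c i => dist1_loopHol_le hθ0 hU c i
  have hl := FluctuationComparisonRegPrIntLS2BetaNeighbourhoodKernelTorus.dist1_loopHol_four_le_of_near hj U Q ha hloc
  have hgW₁ : ∀ i, dist1 (W₁ i) ≤ τ := fun i => hg c₁ i
  have hgW₂ : ∀ i, dist1 (W₂ i) ≤ τ := fun i => by rw [hW₂]; simp only; rw [GaugeGroup.dist1_conj]; exact hg c₂ i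
  have hgW₃ : ∀ i, dist1 (W₃ i) ≤ τ := fun i => by rw [hW₃]; simp only; rw [GaugeGroup.dist1_conj, GaugeGroup.dist1_inv]; exact hg c₃ i
  have hgW₄ : ∀ i, dist1 (W₄ i) ≤ τ := fun i => by rw [hW₄]; simp only; rw [GaugeGroup.dist1_conj, GaugeGroup.dist1_inv]; exact hg c₄ i
  have hlW₁ : ∀ i, dist1 (W₁ i) ≤ τa := fun i => (hl i).1
  have hlW₂ : ∀ i, dist1 (W₂ i) ≤ τa := fun i => by rw [hW₂]; simp only; rw [GaugeGroup.dist1_conj]; exact (hl i).2.1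
  have hlW₃ : ∀ i, dist1 (W₃ i) ≤ τa := fun i => by rw [hW₃]; simp only; rw [GaugeGroup.dist1_conj, GaugeGroup.dist1_inv]; exact (hl i).2.2.1
  have hlW₄ : ∀ i, dist1 (W₄ i) ≤ τa := fun i => by rw [hW₄]; simp only; rw [GaugeGroup.dist1_conj, GaugeGroup.dist1_inv]; exact (hl i).2.2.2
  -- ### the context `H₀ = U(∂□_L(emb y))` (lit `plaqSmall_axialAvg`)
  have hH₀d : dist1 H₀ ≤ τ := by
    have h := plaqSmall_axialAvg hj hU Q
    exact (le_of_lt h).trans hL2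
  -- ### the guard and the loop form (✓G9)
  have hSm : ∀ c, Small ℰ U c := fun c => small_of_plaqSmall ℰ hθ0 hU hδ c
  have hword : GaugeField.plaqHol (avgFun ℰ U) Q = ℰ.avg W₁ * ℰ.avg W₂ * ℰ.avg W₃ * ℰ.avg W₄ * H₀ :=
    FluctuationComparisonRegPrIntLS2BetaPlaquetteWordLoopForm.plaqWord_avgFun_eq_loopForm ℰ U c₁ c₂ c₃ c₄ (hSm c₁) (hSm c₂) (hSm c₃) (hSm c₄)
  -- ### matrix currency: logs of members, sizes, `exp ∘ log`, the averages as `exp[mean log]`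
  have hN : (0 : ℝ) < Fintype.card (Idx P) := Nat.cast_pos.mpr Fintype.card_pos
  set a₁ : Idx P → Matrix n n ℂ := fun i => mlog (W₁ i : Matrix n n ℂ) with ha₁
  set a₂ : Idx P → Matrix n n ℂ := fun i => mlog (W₂ i : Matrix n n ℂ) with ha₂
  set a₃ : Idx P → Matrix n n ℂ := fun i => mlog (W₃ i : Matrix n n ℂ) with ha₃
  set a₄ : Idx P → Matrix n n ℂ := fun i => mlog (W₄ i : Matrix n n ℂ) with ha₄
  have hτh : τ ≤ 1 / 2 := by linarith
  have size : ∀ (W : Idx P → Matrix.specialUnitaryGroup n ℂ) (t : ℝ), (∀ i, dist1 (W i) ≤ τ) → (∀ i, dist1 (W i) ≤ t) →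
      ∀ i, ‖mlog (W i : Matrix n n ℂ)‖ ≤ 2 * t := fun W t hWτ hWt i => by
    have h1 : ‖(W i : Matrix n n ℂ) - 1‖ ≤ 1 / 2 := (hWτ i).trans hτh
    exact (norm_mlog_le_two_mul h1).trans (by have := hWt i; have : ‖(W i : Matrix n n ℂ) - 1‖ ≤ t := this; linarith)
  have hρ₁ : ∀ i, ‖a₁ i‖ ≤ 2 * τ := size W₁ τ hgW₁ hgW₁
  have hρ₂ : ∀ i, ‖a₂ i‖ ≤ 2 * τ := size W₂ τ hgW₂ hgW₂
  have hρ₃ : ∀ i, ‖a₃ i‖ ≤ 2 * τ := size W₃ τ hgW₃ hgW₃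
  have hρ₄ : ∀ i, ‖a₄ i‖ ≤ 2 * τ := size W₄ τ hgW₄ hgW₄
  have hρl₁ : ∀ i, ‖a₁ i‖ ≤ 2 * τa := size W₁ τa hgW₁ hlW₁
  have hρl₂ : ∀ i, ‖a₂ i‖ ≤ 2 * τa := size W₂ τa hgW₂ hlW₂
  have hρl₃ : ∀ i, ‖a₃ i‖ ≤ 2 * τa := size W₃ τa hgW₃ hlW₃
  have hρl₄ : ∀ i, ‖a₄ i‖ ≤ 2 * τa := size W₄ τa hgW₄ hlW₄
  have hexp : ∀ (W : Idx P → Matrix.specialUnitaryGroup n ℂ), (∀ i, dist1 (W i) ≤ τ) →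
      ∀ i, exp (mlog (W i : Matrix n n ℂ)) = (W i : Matrix n n ℂ) := fun W hW i =>
    exp_mlog ((show ‖(W i : Matrix n n ℂ) - 1‖ ≤ τ from hW i).trans_lt (by linarith))
  have havg : ∀ (W : Idx P → Matrix.specialUnitaryGroup n ℂ), (∀ i, dist1 (W i) ≤ τ) →
      ((ℰ.avg W : Matrix.specialUnitaryGroup n ℂ) : Matrix n n ℂ) =
        exp (((Fintype.card (Idx P) : ℝ))⁻¹ • ∑ i, mlog (W i : Matrix n n ℂ)) := fun W hW =>
    coe_avg_eq_exp_mean W fun i => (hW i).trans_lt hδ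
  -- ### the word in matrix form: `Ū(∂Q) = e^{ā₁} e^{ā₂} e^{ā₃} e^{ā₄} H₀`
  have hplaqM : ((GaugeField.plaqHol (avgFun ℰ U) Q : Matrix.specialUnitaryGroup n ℂ) : Matrix n n ℂ) =
      exp (((Fintype.card (Idx P) : ℝ))⁻¹ • ∑ i, a₁ i) * exp (((Fintype.card (Idx P) : ℝ))⁻¹ • ∑ i, a₂ i) *
        exp (((Fintype.card (Idx P) : ℝ))⁻¹ • ∑ i, a₃ i) * exp (((Fintype.card (Idx P) : ℝ))⁻¹ • ∑ i, a₄ i) * (H₀ : Matrix n n ℂ) := by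
    rw [hword]
    simp only [Submonoid.coe_mul]
    rw [havg W₁ hgW₁, havg W₂ hgW₂, havg W₃ hgW₃, havg W₄ hgW₄]
  -- ### the context size
  have hHn : ‖(H₀ : Matrix n n ℂ) - 1‖ ≤ Real.exp (2 * τ) - 1 := by
    have h1 : ‖(H₀ : Matrix n n ℂ) - 1‖ ≤ τ := hH₀d
    have h2 := Real.add_one_le_exp (2 * τ)
    linarith
  -- ### (C) HYBRID ×4 (✓G10): `‖log Ū(∂Q) − nested mean‖ ≤ 32768·τ·τ_loc`
  have hG10 := FluctuationComparisonRegPrIntLS2BetaHybridFourSlot.norm_mlog_word4_sub_mean4_le a₁ a₂ a₃ a₄ (H₀ : Matrix n n ℂ)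
    (ρ := 2 * τ) (by linarith) hρ₁ hρ₂ hρ₃ hρ₄ hHn
  rw [← hplaqM] at hG10
  have hfl : ∀ (b : Idx P → Matrix n n ℂ), (∀ i, ‖b i‖ ≤ 2 * τa) →
      ((Fintype.card (Idx P) : ℝ))⁻¹ * ∑ i, ‖b i - ((Fintype.card (Idx P) : ℝ))⁻¹ • ∑ i', b i'‖ ≤ 4 * τa := fun b hb => by
    refine mean_le _ fun i => ?_
    have hm := FluctuationComparisonRegPrIntLS2BetaHybridFourSlot.norm_mean_le b hb
    calc ‖b i - ((Fintype.card (Idx P) : ℝ))⁻¹ • ∑ i', b i'‖ ≤ ‖b i‖ + ‖((Fintype.card (Idx P) : ℝ))⁻¹ • ∑ i', b i'‖ := norm_sub_le _ _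
      _ ≤ 2 * τa + 2 * τa := add_le_add (hb i) hm
      _ = 4 * τa := by ring
  have he : Real.exp (4 * (2 * τ)) - 1 ≤ 16 * τ := by
    have h := Real.abs_exp_sub_one_le (x := 4 * (2 * τ)) (by rw [abs_of_nonneg (by linarith)]; linarith)
    rw [abs_of_nonneg (by linarith [Real.add_one_le_exp (4 * (2 * τ))]), abs_of_nonneg (by linarith)] at h
    linarith
  have he0 : 0 ≤ Real.exp (4 * (2 * τ)) - 1 := by linarith [Real.add_one_le_exp (4 * (2 * τ))]
  have hfl₁ := hfl a₁ hρl₁; have hfl₂ := hfl a₂ hρl₂; have hfl₃ := hfl a₃ hρl₃; have hfl₄ := hfl a₄ hρl₄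
  have hF : _ ≤ 4 * τa + 4 * τa + 4 * τa + 4 * τa := add_le_add (add_le_add (add_le_add hfl₁ hfl₂) hfl₃) hfl₄
  have hF0 : 0 ≤ 4 * τa + 4 * τa + 4 * τa + 4 * τa := by linarith only [hτa0]
  have hEF := mul_le_mul he hF (by positivity) (by linarith only [hτ0])
  have hJ₁ := hG10.trans (show _ ≤ 32768 * τ * τa from by
    have h64 : (0 : ℝ) ≤ 64 * 2 := by norm_num
    have := mul_le_mul_of_nonneg_left hEF h64
    linarith only [this])
  -- ### (D) CHAIN COUPLING (✓G14 = ✓G5 §3 + ✓G6 ×3) along `τ, 1, τ`: `‖chain mean − nested mean‖ ≤ 12288·τ·τ_loc`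
  set τp : Equiv.Perm (Idx P) := Equiv.prodCongr (Equiv.refl _) (Equiv.prodComm _ _) with hτpdef
  have hτp : ∀ i : Idx P, τp i = (i.1, i.2.2, i.2.1) := fun i => rfl
  have hs : ∀ (b : Idx P → Matrix n n ℂ), (∀ i, ‖b i‖ ≤ 2 * τ) → ∀ j j', ‖b j - b j'‖ ≤ 4 * τ := fun b hb j j' =>
    (norm_sub_le _ _).trans (by linarith [hb j, hb j'])
  have hG14 := FluctuationComparisonRegPrIntLS2BetaChainCouplingCost.norm_chain4_sub_nestedMean4_le a₁ a₂ a₃ a₄ (H₀ : Matrix n n ℂ)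
    (ρ := 2 * τ) (by linarith) hρ₁ hρ₂ hρ₃ hρ₄ hHn τp 1 τp 1 1 1 (hs a₂ hρ₂) (hs a₃ hρ₃) (hs a₄ hρ₄)
  -- the three local means: products of members are within `kτ_loc` of `1`
  have hx₁ : ∀ i, exp (a₁ i) = (W₁ i : Matrix n n ℂ) := hexp W₁ hgW₁
  have hx₂ : ∀ i, exp (a₂ i) = (W₂ i : Matrix n n ℂ) := hexp W₂ hgW₂
  have hx₃ : ∀ i, exp (a₃ i) = (W₃ i : Matrix n n ℂ) := hexp W₃ hgW₃
  have hx₄ : ∀ i, exp (a₄ i) = (W₄ i : Matrix n n ℂ) := hexp W₄ hgW₄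
  have hP₁ : ∀ x, ‖(W₁ x : Matrix n n ℂ) - 1‖ ≤ τa := fun x => by rw [← FederbushMean.dist1_SU_eq]; exact hlW₁ x
  have hP₂ : ∀ x y, ‖(W₁ x : Matrix n n ℂ) * (W₂ y : Matrix n n ℂ) - 1‖ ≤ 2 * τa := fun x y => by
    rw [← Submonoid.coe_mul, ← FederbushMean.dist1_SU_eq]
    calc dist1 (W₁ x * W₂ y) ≤ dist1 (W₁ x) + dist1 (W₂ y) := GaugeGroup.dist1_mul_le _ _
      _ ≤ τa + τa := add_le_add (hlW₁ x) (hlW₂ y)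
      _ = 2 * τa := by ring
  have hP₃ : ∀ x y z, ‖(W₁ x : Matrix n n ℂ) * (W₂ y : Matrix n n ℂ) * (W₃ z : Matrix n n ℂ) - 1‖ ≤ 3 * τa := fun x y z => by
    rw [← Submonoid.coe_mul, ← Submonoid.coe_mul, ← FederbushMean.dist1_SU_eq]
    calc dist1 (W₁ x * W₂ y * W₃ z) ≤ dist1 (W₁ x * W₂ y) + dist1 (W₃ z) := GaugeGroup.dist1_mul_le _ _
      _ ≤ dist1 (W₁ x) + dist1 (W₂ y) + dist1 (W₃ z) := add_le_add (GaugeGroup.dist1_mul_le _ _) le_rfl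
      _ ≤ τa + τa + τa := add_le_add (add_le_add (hlW₁ x) (hlW₂ y)) (hlW₃ z)
      _ = 3 * τa := by ring
  have hm₁ : ((Fintype.card (Idx P) : ℝ))⁻¹ * ∑ i, ‖exp (a₁ i) - 1‖ ≤ τa :=
    mean_le _ fun i => by rw [hx₁]; exact hP₁ i
  have hm₂ : ((Fintype.card (Idx P) : ℝ))⁻¹ * ∑ i, ‖exp (a₁ (τp.symm i)) * exp (a₂ i) - 1‖ ≤ 2 * τa :=
    mean_le _ fun i => by rw [hx₁, hx₂]; exact hP₂ _ _
  have hm₃ : ((Fintype.card (Idx P) : ℝ))⁻¹ * ∑ i, ‖exp (a₁ (τp.symm ((1 : Equiv.Perm (Idx P)).symm i))) *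
      exp (a₂ ((1 : Equiv.Perm (Idx P)).symm i)) * exp (a₃ i) - 1‖ ≤ 3 * τa :=
    mean_le _ fun i => by rw [hx₁, hx₂, hx₃]; exact hP₃ _ _ _
  have hs0 : (0 : ℝ) ≤ 2 * 256 * (4 * τ) := by linarith only [hτ0]
  have hk₁ := mul_le_mul_of_nonneg_left hm₁ hs0
  have hk₂ := mul_le_mul_of_nonneg_left hm₂ hs0
  have hk₃ := mul_le_mul_of_nonneg_left hm₃ hs0
  have hJ₂ := hG14.trans (show _ ≤ 12288 * τ * τa from by linarith only [hk₁, hk₂, hk₃])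
  -- ### (E) THE MAIN TERM: the chain word is the conjugated sharp square (✓FILE 1), `log` costs `1 + 2τ`, the member mean is the tent kernel
  have hdiag : ∀ i : Idx P, ‖mlog (exp (a₁ i) * exp (a₂ (τp i)) * exp (a₃ ((1 : Equiv.Perm (Idx P)) (τp i))) *
      exp (a₄ (τp ((1 : Equiv.Perm (Idx P)) (τp i)))) * (H₀ : Matrix n n ℂ))‖ ≤
      (1 + 2 * τ) * dist1 (rect U (Site.blockSite Q.src i.1) Q.μ Q.ν P.L P.L) := fun i => by
    have hone : ∀ x : Idx P, (1 : Equiv.Perm (Idx P)) x = x := fun x => rfl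
    have hττ : τp (τp i) = i := rfl
    rw [hone, hττ, hx₁, hx₂, hx₃, hx₄, ← Submonoid.coe_mul, ← Submonoid.coe_mul, ← Submonoid.coe_mul, ← Submonoid.coe_mul]
    have hw : W₁ i * W₂ (τp i) * W₃ (τp i) * W₄ i * H₀ =
        holAt U (walk (emb Q.src) (stairWord i.2.1 (off i.1))) * rect U (Site.blockSite Q.src i.1) Q.μ Q.ν P.L P.L *
          (holAt U (walk (emb Q.src) (stairWord i.2.1 (off i.1))))⁻¹ := by
      rw [hτp]; exact memberWord_eq_conj_rect hj U Q i
    rw [hw, Submonoid.coe_mul, Submonoid.coe_mul, norm_mlog_conj_eq]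
    have hR : dist1 (rect U (Site.blockSite Q.src i.1) Q.μ Q.ν P.L P.L) ≤ τ := (dist1_rect_le_sq_mul U hU _ Q.hμν).trans hL2
    rw [FederbushMean.dist1_SU_eq] at hR ⊢
    exact norm_mlog_le_one_add_mul hR hτh
  have hK := FluctuationComparisonRegPrIntLS2BetaCoupledWordSquare.mean_dist1_rect_le_tentKernel hj U Q
  have hsum : ((Fintype.card (Idx P) : ℝ))⁻¹ * ∑ i : Idx P, (1 + 2 * τ) * dist1 (rect U (Site.blockSite Q.src i.1) Q.μ Q.ν P.L P.L) ≤
      (1 + 2 * τ) * ∑ p : Plaq P j, ((P.L : ℝ) ^ P.d)⁻¹ * (((block Q.src).filter (fun x : Site P j => p.μ = Q.μ ∧ p.ν = Q.ν ∧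
        ∃ a ∈ range P.L, ∃ b ∈ range P.L, p.src = shiftN (shiftN x Q.μ a) Q.ν b)).card : ℝ) * dist1 (GaugeField.plaqHol U p) := by
    rw [← Finset.mul_sum, ← mul_assoc, mul_comm _ (1 + 2 * τ), mul_assoc]
    exact mul_le_mul_of_nonneg_left hK (by linarith only [hτ0])
  have hmain := (norm_mean_le_mean _ _ hdiag).trans hsum
  -- ### (F) COLLECTING: `dist1 ≤ (1 + m)·m`, `m ≤ J₁ + J₂ + (1 + 2τ)·ΣKf`
  have hm := norm_le_of_two_anchors hJ₁ hJ₂ hmain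
  clear hJ₁ hJ₂ hmain hsum hdiag hG10 hG14 hk₁ hk₂ hk₃ hm₁ hm₂ hm₃ hEF hF hF0 hfl₁ hfl₂ hfl₃ hfl₄ hfl hplaqM
  -- sizes of the averaged plaquette itself (lit Prop. 1, crude form)
  have hplaq : ‖((GaugeField.plaqHol (avgFun ℰ U) Q : Matrix.specialUnitaryGroup n ℂ) : Matrix n n ℂ) - 1‖ ≤ 25 * τ := by
    have h := BlockAveragingPlaquetteBound.dist1_plaqHol_avgFun_lt hj hθ0 hU hδ Q
    have h' : dist1 (GaugeField.plaqHol (avgFun ℰ U) Q) ≤ ((P.L : ℝ) ^ 2 + 6 * (((P.d + 2) * P.L : ℕ) : ℝ) ^ 2) * θ := le_of_lt h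
    have e : ((P.L : ℝ) ^ 2 + 6 * (((P.d + 2) * P.L : ℕ) : ℝ) ^ 2) * θ = (P.L : ℝ) ^ 2 * θ + 24 * τ := by rw [hτdef, hcc]; ring
    rw [e, FederbushMean.dist1_SU_eq] at h'
    linarith only [h', hL2]
  have hm50 : ‖mlog ((GaugeField.plaqHol (avgFun ℰ U) Q : Matrix.specialUnitaryGroup n ℂ) : Matrix n n ℂ)‖ ≤ 50 * τ :=
    (norm_mlog_le_two_mul (hplaq.trans (by linarith only [hτs]))).trans (by linarith only [hplaq])
  have hm0 : 0 ≤ ‖mlog ((GaugeField.plaqHol (avgFun ℰ U) Q : Matrix.specialUnitaryGroup n ℂ) : Matrix n n ℂ)‖ := norm_nonneg _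
  have hK0 : 0 ≤ ∑ p : Plaq P j, ((P.L : ℝ) ^ P.d)⁻¹ * (((block Q.src).filter (fun x : Site P j => p.μ = Q.μ ∧ p.ν = Q.ν ∧
        ∃ a ∈ range P.L, ∃ b ∈ range P.L, p.src = shiftN (shiftN x Q.μ a) Q.ν b)).card : ℝ) * dist1 (GaugeField.plaqHol U p) :=
    Finset.sum_nonneg fun p _ => mul_nonneg (mul_nonneg (inv_nonneg.mpr (pow_nonneg (Nat.cast_nonneg _) _)) (Nat.cast_nonneg _))
      (GaugeGroup.dist1_nonneg _)
  have hfin := norm_sub_one_le_one_add_mul (hplaq.trans_lt (by linarith only [hτs])) (hm50.trans (by linarith only [hτs]))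
  have hc2 : (((P.d + 2) * P.L : ℕ) : ℝ) ^ 2 = 4 * cc := by rw [hcc]; ring
  have hc4 : (((P.d + 2) * P.L : ℕ) : ℝ) ^ 4 = 16 * cc ^ 2 := by rw [hcc]; ring
  rw [FederbushMean.dist1_SU_eq, hc2, hc4]
  generalize hSg : (∑ p : Plaq P j, ((P.L : ℝ) ^ P.d)⁻¹ * (((block Q.src).filter (fun x : Site P j => p.μ = Q.μ ∧ p.ν = Q.ν ∧
        ∃ a ∈ range P.L, ∃ b ∈ range P.L, p.src = shiftN (shiftN x Q.μ a) Q.ν b)).card : ℝ) * dist1 (GaugeField.plaqHol U p)) = S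
    at hm hK0 ⊢
  generalize hmg : ‖mlog ((GaugeField.plaqHol (avgFun ℰ U) Q : Matrix.specialUnitaryGroup n ℂ) : Matrix n n ℂ)‖ = m at hm hm50 hm0 hfin
  have hccθa : cc ^ 2 * θ * a = τ * τa := by rw [hτdef, hτadef]; ring
  have h1 : (1 + m) * m ≤ (1 + 50 * τ) * (45056 * τ * τa + (1 + 2 * τ) * S) := by
    have hA : 0 ≤ 45056 * τ * τa + (1 + 2 * τ) * S := by nlinarith only [hτ0, hτa0, hK0]
    calc (1 + m) * m ≤ (1 + m) * (45056 * τ * τa + (1 + 2 * τ) * S) :=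
          mul_le_mul_of_nonneg_left (by linarith only [hm]) (by linarith only [hm0])
      _ ≤ (1 + 50 * τ) * (45056 * τ * τa + (1 + 2 * τ) * S) := mul_le_mul_of_nonneg_right (by linarith only [hm50]) hA
  have h2 : (1 + 50 * τ) * (45056 * τ * τa + (1 + 2 * τ) * S) ≤ (1 + 14 * (4 * cc) * θ) * S + 4096 * (16 * cc ^ 2) * θ * a := by
    have e1 : (1 + 14 * (4 * cc) * θ) * S + 4096 * (16 * cc ^ 2) * θ * a = (1 + 56 * τ) * S + 65536 * (τ * τa) := by
      rw [← hccθa, hτdef]; ring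
    rw [e1]
    nlinarith only [hτ0, hτa0, hK0, hτs, mul_nonneg hτ0 hK0, mul_nonneg (mul_nonneg hτ0 hτ0) hK0, mul_nonneg hτ0 (mul_nonneg hτ0 hτa0)]
  exact hfin.trans (h1.trans h2)

/-- ★★★ **THE (C)-STEP WITH THE NEIGHBOURHOOD SUM AS THE LOCAL DATUM**: `dist1 Ū(∂Q) ≤ (1 + 14·((d+2)L)²·θ)·Σ_p K Q p·dist1 U(∂p) + 4096·((d+2)L)⁴·θ·Σ_{q ∈ N(Q₋)} dist1 U(∂q)`
(`a := Σ_{N(Q₋)} dist1 + η`, `η ↓ 0`). [cite: Balaban1987RG1, (0.4)-(0.8) p.253] -/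
theorem oneLevelStep_nbhd (hj : j + 1 ≤ P.m + P.K) (U : GaugeField P j (Matrix.specialUnitaryGroup n ℂ)) {θ : ℝ} (hθ0 : 0 ≤ θ)
    (hθ : (((P.d + 2) * P.L : ℕ) : ℝ) ^ 2 * θ ≤ 1 / 50) (hδ : (((P.d + 2) * P.L : ℕ) : ℝ) ^ 2 / 4 * θ < deltaSU n)
    (hU : PlaqSmall θ U) (Q : Plaq P (j + 1)) :
    dist1 (GaugeField.plaqHol (avgFun (expMeanLogSU (n := n)) U) Q) ≤
      (1 + 14 * (((P.d + 2) * P.L : ℕ) : ℝ) ^ 2 * θ) *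
          ∑ p : Plaq P j, ((P.L : ℝ) ^ P.d)⁻¹ * (((block Q.src).filter (fun x : Site P j => p.μ = Q.μ ∧ p.ν = Q.ν ∧
            ∃ a ∈ range P.L, ∃ b ∈ range P.L, p.src = shiftN (shiftN x Q.μ a) Q.ν b)).card : ℝ) * dist1 (GaugeField.plaqHol U p) +
        4096 * (((P.d + 2) * P.L : ℕ) : ℝ) ^ 4 * θ *
          ∑ q ∈ Finset.univ.filter (fun q : Plaq P j => ∀ κ, blockOf q.src κ = Q.src κ ∨ blockOf q.src κ = Q.src κ + 1 ∨
            blockOf q.src κ = Q.src κ - 1), dist1 (GaugeField.plaqHol U q) := by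
  set B : ℝ := 4096 * (((P.d + 2) * P.L : ℕ) : ℝ) ^ 4 * θ with hB
  set SN : ℝ := ∑ q ∈ Finset.univ.filter (fun q : Plaq P j => ∀ κ, blockOf q.src κ = Q.src κ ∨ blockOf q.src κ = Q.src κ + 1 ∨
      blockOf q.src κ = Q.src κ - 1), dist1 (GaugeField.plaqHol U q) with hSN
  have hB0 : 0 ≤ B := by positivity
  have hSN0 : 0 ≤ SN := Finset.sum_nonneg fun q _ => GaugeGroup.dist1_nonneg _
  refine le_of_forall_pos_le_add fun ε hε => ?_
  have hη : 0 < ε / (B + 1) := div_pos hε (by linarith)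
  have h := oneLevelStep hj U hθ0 hθ hδ hU Q (a := SN + ε / (B + 1)) (by positivity)
    (fun q hq => FluctuationComparisonRegPrIntLS2BetaNeighbourhoodKernelTorus.lt_nbhd_sum_add U Q.src hη q hq)
  have hBε : B * (ε / (B + 1)) ≤ ε := by
    rw [mul_div_assoc']
    exact (div_le_iff₀ (by linarith)).mpr (by nlinarith)
  calc _ ≤ _ := h
    _ = _ + B * SN + B * (ε / (B + 1)) := by rw [hB]; ring
    _ ≤ _ + B * SN + ε := add_le_add le_rfl hBε

/-- ★★★ **THE `hstep` ∕ `hj` PAIR OF ✓`…KeyLemmaSkeleton.keyLemma_level`, DISCHARGED for one (0.4) averaging with `exp[mean log]` on `SU(N)`** (standing range, `PlaqSmall θ U`,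
`((d+2)L)²·θ ≤ 1∕50`, `((d+2)L)²∕4·θ < δ_N`): with `f p := dist1 U(∂p)`, `f′ Q := dist1 Ū(∂Q)`, `K Q p :=` px12's tent kernel (✓`…TentKernelTorus`: rows `L²`, columns `≤ L^{2−d}`),
`j Q := 4096·((d+2)L)⁴·θ·Σ_{q ∈ N(Q₋)} f q`, `θ_t := 14·((d+2)L)²·θ`, `ε_t := 4096·((d+2)L)⁴·θ·√((3^d L^d d²)(3^d d²))`:
(hstep) `∀ Q, f′ Q ≤ (1 + θ_t)·Σ_p K Q p·f p + j Q` and (hj) `√(Σ_Q (j Q)²) ≤ ε_t·√(Σ_p (f p)²)` (✓FILE 2 `sqrt_sum_sq_le_of_le_nbhd_sum`). [cite: Balaban1985RegularSpaces, Lemma 1 p.79] -/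
theorem hstep_hj (hj : j + 1 ≤ P.m + P.K) (U : GaugeField P j (Matrix.specialUnitaryGroup n ℂ)) {θ : ℝ} (hθ0 : 0 ≤ θ)
    (hθ : (((P.d + 2) * P.L : ℕ) : ℝ) ^ 2 * θ ≤ 1 / 50) (hδ : (((P.d + 2) * P.L : ℕ) : ℝ) ^ 2 / 4 * θ < deltaSU n)
    (hU : PlaqSmall θ U) :
    (∀ Q : Plaq P (j + 1), dist1 (GaugeField.plaqHol (avgFun (expMeanLogSU (n := n)) U) Q) ≤
      (1 + 14 * (((P.d + 2) * P.L : ℕ) : ℝ) ^ 2 * θ) *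
          ∑ p : Plaq P j, ((P.L : ℝ) ^ P.d)⁻¹ * (((block Q.src).filter (fun x : Site P j => p.μ = Q.μ ∧ p.ν = Q.ν ∧
            ∃ a ∈ range P.L, ∃ b ∈ range P.L, p.src = shiftN (shiftN x Q.μ a) Q.ν b)).card : ℝ) * dist1 (GaugeField.plaqHol U p) +
        4096 * (((P.d + 2) * P.L : ℕ) : ℝ) ^ 4 * θ *
          ∑ q ∈ Finset.univ.filter (fun q : Plaq P j => ∀ κ, blockOf q.src κ = Q.src κ ∨ blockOf q.src κ = Q.src κ + 1 ∨
            blockOf q.src κ = Q.src κ - 1), dist1 (GaugeField.plaqHol U q)) ∧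
    √(∑ Q : Plaq P (j + 1), (4096 * (((P.d + 2) * P.L : ℕ) : ℝ) ^ 4 * θ *
          ∑ q ∈ Finset.univ.filter (fun q : Plaq P j => ∀ κ, blockOf q.src κ = Q.src κ ∨ blockOf q.src κ = Q.src κ + 1 ∨
            blockOf q.src κ = Q.src κ - 1), dist1 (GaugeField.plaqHol U q)) ^ 2) ≤
      4096 * (((P.d + 2) * P.L : ℕ) : ℝ) ^ 4 * θ * √(((3 ^ P.d * P.L ^ P.d * P.d ^ 2 : ℕ) : ℝ) * ((3 ^ P.d * P.d ^ 2 : ℕ) : ℝ)) *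
        √(∑ p : Plaq P j, dist1 (GaugeField.plaqHol U p) ^ 2) :=
  ⟨fun Q => oneLevelStep_nbhd hj U hθ0 hθ hδ hU Q,
    FluctuationComparisonRegPrIntLS2BetaNeighbourhoodKernelTorus.sqrt_sum_sq_le_of_le_nbhd_sum hj (fun p => dist1 (GaugeField.plaqHol U p)) _
      (by positivity) (fun Q => mul_nonneg (by positivity) (Finset.sum_nonneg fun q _ => GaugeGroup.dist1_nonneg _)) (fun Q => le_rfl)⟩

end Step

end Summit.QuantumFields.YangMills.Theorems.FluctuationComparisonRegPrIntLS2BetaOneLevelStep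

end
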